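import Summits.BirchSwinnertonDyer.BirchSwinnertonDyer.Theorems.AlignedTransportAtTwoMainConjectureOfRankZeroBSDAtTwoFineRoadOddSplitDescent
import Summits.BirchSwinnertonDyer.BirchSwinnertonDyer.Theorems.AlignedTransportAtTwoMainConjectureOfRankZeroBSDAtTwoFineRoadLocalTwo
import Summits.BirchSwinnertonDyer.BirchSwinnertonDyer.Theorems.AlignedTransportAtTwoMainConjectureOfRankZeroBSDAtTwoFineRoadInfResSurj
import Literature.NumberTheory.EllipticCurves.IwasawaTowerTorsionOrdinaryProofs
import HarnessLib

/-!
# Road (b″) netted, local brick (ii) packaged on the seed cell: the FINE descent defect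
# `{c ∈ H¹(ℚ_∞, E[2^∞]) | res c ∈ Sel₀(ℚ(ζ_{2^∞}))} / Sel₀^{rel ∞}(ℚ_∞)` is FINITE (no Imai, no Ribet)

Cell `bsd-f1-sign2`, WIDTH-5 attach seat `bsd-line-att-p4` (gen 4) on line `birth` of crux C2
stmt-BirchSwinnertonDyer-22298 `MainConjectureOfRankZeroBSDAtTwo`; a `--supports 22298 --as helper` file assembling
`…FineRoadOddSplitDescent` (odd places: nothing), `…FineRoadLocalTwo` (the inf–res defect at `2` is finite) and the
total ramification of `2` in `ℚ_∞` (tree `ZpExtension.IsCyclotomic.exists_mem_inertia_inv_mul_mem_kerSubgroup`).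
HONEST FRAMING: THEOREMS ONLY — no definition, no named fact, no `sorry`; BSD is NOT proved by any of this.

* §1 (any number field, `H ⊴ Γ_K`, discrete `M`) `conjH1_mem_awayKer_iff_of_mem_decomp` — for `d ∈ D_v`, `conj_d c` is
  locally trivial at the chosen place above `v` iff `c` is (explicit cocycles, `CocycleCriteria`);
  `forall_conjH1_mem_awayKer_iff` — if every `σ ∈ Γ_K` is `d · h` with `d ∈ D_v`, `h ∈ H` (ONE place of `K̄^H` above
  `v`), then «`conj_σ c` locally trivial above `v` for all `σ`» ⟺ «`c` locally trivial above `v`».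
* §2 (`K = ℚ`, cyclotomic `κ`, the place `v ∋ 2`) `exists_mem_decomp_inv_mul_mem_kerSubgroup_two` (`Γ_ℚ = D_v · ker κ`:
  `2` is totally ramified in `ℚ_∞`, one prime above it); `forall_conjH1_mem_awayKer_iff_two`.
* §3 **`finite_fineDefect_two`**: for every elliptic `W/ℚ`, with `L = {c ∈ H¹(ℚ_∞, E[2^∞]) | res c ∈ Sel₀(ℚ(ζ_{2^∞}), E[2^∞])}`
  (Greenberg's strict Selmer group of the fine data over `ker χ₂`; `Sel₀^{rel ∞}(ℚ_∞) ≤ L`,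
  `fineSelmerInftyRelaxedInf_le_fineDefectSource`): **`L / Sel₀^{rel ∞}(ℚ_∞)` is FINITE.** Indeed by
  `OddSplitDescent.mem_fineSelmerInftyRelaxedInf_iff_resOfLe_mem_and_above_two` and §2, `c ∈ L` lies in `Sel₀^{rel ∞}` iff it
  is locally trivial at the place above `2`, i.e. iff `res_{ker κ ⊓ D₂} c = 0`; and `res_{ker κ ⊓ D₂}(L)` lies in the
  kernel of the further restriction to `ker χ₂ ⊓ D₂`, finite by `LocalTwo.finite_ker_res_kerCyclotomicCharacter_inf_two`.
  Together with att-p4 g3 (`…InfResSharp`/`…InfResSurj`: on the seed cell `res` maps `H¹(ℚ_∞, E[2^∞])` ISOMORPHICALLY onto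
  the `Δ`-invariants) this says: `coker(res₀ : Sel₀^{rel ∞}(ℚ_∞) → Sel₀(ℚ(ζ_{2^∞}))^Δ)` is finite, so its Pontryagin dual
  `ker fyʳ` is finite and `ℓ₍₂₎(ker fyʳ) = 0` — the inf–res conjunct of the displayed `KatoNetDataRelAtTwo` (K₂ⁿᵉᵗʳ), for
  BOTH signs of `Δ_W`, with NO appeal to Imai 1975 or Ribet 1981.

* §4 **`finite_coker_fineRestriction_two`** (seed cell: no rational `2`-torsion): the `Δ`-invariant classes of
  `Sel₀(ℚ(ζ_{2^∞}), E[2^∞])` modulo `res(Sel₀^{rel ∞}(ℚ_∞))` form a FINITE group — `coker(res₀)` finite, literally.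

References: R. Greenberg, LNM 1716 (1999), §3 (Lemma 3.1, restriction maps) and §4 p. 106; J.-P. Serre, *Galois Cohomology*
I §2.6; L. Washington, *Cyclotomic Fields* §13.1 (total ramification); K. Kato, Astérisque 295 §17.13.
-/

set_option autoImplicit false
-- the Theorems namespace of this sub repeats the summit name by design (D-0017 nested layout)
set_option linter.dupNamespace false

noncomputable section

open scoped Classical

namespace Summit.BirchSwinnertonDyer.BirchSwinnertonDyer.Theorems.AlignedTransportAtTwoFineRoad.CokerAtTwo

open WeierstrassCurve NumberField IsDedekindDomain Field Literature.NumberTheory.EllipticCurves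
  Literature.NumberTheory.EllipticCurves.GreenbergSelmer Literature.NumberTheory.GaloisRepresentations ZpExtension

/-! ## §1 Conjugation by the decomposition group preserves «locally trivial above `v`» -/

section Conj

variable {K : Type} [Field K] [NumberField K] (H : Subgroup (absoluteGaloisGroup K)) [H.Normal]
  (M : Type) [AddCommGroup M] [DistribMulAction (absoluteGaloisGroup K) M] [TopologicalSpace M]
  [DiscreteTopology M]

/-- For `d` in the decomposition group `D_v` and `c ∈ H¹(H, M)` locally trivial at the chosen place above `v`
(`res_{H ⊓ D_v} c = 0`), the conjugate `conj_d c` is locally trivial there too: on cocycles, if `z = ∂a` on `H ⊓ D_v`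
then `x ↦ d • z(d⁻¹ x d)` is `∂(d • a)` on `H ⊓ D_v` (`d⁻¹ x d ∈ H ⊓ D_v`). [cite: SerreGaloisCohomology1997, I §2.5 (conjugation on `H¹(H, M)`)] -/
theorem conjH1_mem_awayKer_of_mem_decomp {v : HeightOneSpectrum (𝓞 K)} {d : absoluteGaloisGroup K}
    (hd : d ∈ decomp v) {c : subgroupH1 H M} (hc : c ∈ awayKer H M v) :
    conjH1 H M d c ∈ awayKer H M v := by
  obtain ⟨z, rfl⟩ := oneCocycleClass_surjective _ c
  rw [awayKer, AddMonoidHom.mem_ker] at hc ⊢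
  obtain ⟨a, ha⟩ :=
    (CocycleCriteria.resOfLe_oneCocycleClass_eq_zero_iff (inf_le_left : H ⊓ decomp v ≤ H) z).mp hc
  refine (CocycleCriteria.conjH1_oneCocycleClass_mem_ker_resOfLe_iff
    (inf_le_left : H ⊓ decomp v ≤ H) d z).mpr ⟨d • a, fun x ↦ ?_⟩
  have hx' : d⁻¹ * (x : absoluteGaloisGroup K) * d ∈ H ⊓ decomp v :=
    ⟨(inferInstance : H.Normal).conj_mem' _ x.2.1 d,
      (decomp v).mul_mem ((decomp v).mul_mem ((decomp v).inv_mem hd) x.2.2) hd⟩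
  have e : subgroupConj H d (Subgroup.inclusion (inf_le_left : H ⊓ decomp v ≤ H) x) =
      Subgroup.inclusion (inf_le_left : H ⊓ decomp v ≤ H) ⟨_, hx'⟩ := Subtype.ext rfl
  have hmul : d * (d⁻¹ * (x : absoluteGaloisGroup K) * d) = (x : absoluteGaloisGroup K) * d := by group
  rw [e, ha ⟨_, hx'⟩, smul_sub, smul_smul, hmul, mul_smul]

/-- **`conj_d c` is locally trivial above `v` iff `c` is, for `d ∈ D_v`** (apply the previous lemma to `d` and to
`d⁻¹`; `conj_{d⁻¹} ∘ conj_d = id`). [cite: SerreGaloisCohomology1997, I §2.5 (conjugation on `H¹(H, M)`)] -/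
theorem conjH1_mem_awayKer_iff_of_mem_decomp {v : HeightOneSpectrum (𝓞 K)} {d : absoluteGaloisGroup K}
    (hd : d ∈ decomp v) (c : subgroupH1 H M) :
    conjH1 H M d c ∈ awayKer H M v ↔ c ∈ awayKer H M v := by
  refine ⟨fun h ↦ ?_, conjH1_mem_awayKer_of_mem_decomp H M hd⟩
  have h2 := conjH1_mem_awayKer_of_mem_decomp H M ((decomp v).inv_mem hd) h
  rwa [← AddMonoidHom.comp_apply, ← conjH1_mul_holds H M, inv_mul_cancel, conjH1_one_holds H M,
    AddMonoidHom.id_apply] at h2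

/-- **One place above `v` ⟹ one local condition.** If every `σ ∈ Γ_K` factors as `σ = d · h` with `d ∈ D_v` and
`h ∈ H` (i.e. `K̄^H` has a single place above `v`), then «`conj_σ c` is locally trivial at the chosen place above `v`
for EVERY `σ`» (the condition at all places of `K̄^H` above `v`, as imposed in the tree's Selmer groups) is equivalent
to the single condition «`c` is locally trivial there» (`conj_h = id` for `h ∈ H`, `conjH1_of_mem_holds`).
[cite: Greenberg1989, §1 p. 98 ("independent of the choice of places")] -/
theorem forall_conjH1_mem_awayKer_iff {v : HeightOneSpectrum (𝓞 K)}
    (hgen : ∀ σ : absoluteGaloisGroup K, ∃ d ∈ decomp v, d⁻¹ * σ ∈ H) (c : subgroupH1 H M) :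
    (∀ σ : absoluteGaloisGroup K, conjH1 H M σ c ∈ awayKer H M v) ↔ c ∈ awayKer H M v := by
  refine ⟨fun h ↦ ?_, fun h σ ↦ ?_⟩
  · have h1 := h 1
    rwa [conjH1_one_holds H M, AddMonoidHom.id_apply] at h1
  · obtain ⟨d, hd, hh⟩ := hgen σ
    rw [show σ = d * (d⁻¹ * σ) by group, conjH1_mul_holds H M, AddMonoidHom.comp_apply,
      conjH1_of_mem_holds H M hh, AddMonoidHom.id_apply]
    exact conjH1_mem_awayKer_of_mem_decomp H M hd h

end Conj

/-! ## §2 `K = ℚ`: `2` is totally ramified in `ℚ_∞`, so `Γ_ℚ = D_v · ker κ` at the place `v ∋ 2` -/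

section Rat

open Rat.HeightOneSpectrum

variable (κ : ZpExtension ℚ 2)

/-- The place `v` of `ℚ` containing `2` is the prime `2` of Mathlib's `primesEquiv`. [folklore] -/
theorem primesEquiv_eq_two {v : HeightOneSpectrum (𝓞 ℚ)} (hv : ((2 : ℕ) : 𝓞 ℚ) ∈ v.asIdeal) :
    (primesEquiv v : ℕ) = 2 := by
  have hgen : natGenerator v ∣ 2 := by
    rw [natGenerator_dvd_iff, ← map_natCast (Rat.IsIntegralClosure.intEquiv (𝓞 ℚ)) 2,
      Ideal.apply_mem_of_equiv_iff]
    exact hv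
  exact (Nat.prime_dvd_prime_iff_eq (prime_natGenerator v) Nat.prime_two).mp hgen

/-- **`Γ_ℚ = D_v · Gal(ℚ̄/ℚ_∞)` at the place `v ∋ 2`** (cyclotomic `κ`): `2` is totally ramified in `ℚ_∞ = ℚ(ζ_{2^∞})⁺`
(tree `ZpExtension.IsCyclotomic.exists_mem_inertia_inv_mul_mem_kerSubgroup`: `Γ_ℚ = I_{𝔓₀} · ker κ`, and
`I_{𝔓₀} ≤ D_{𝔓₀} = decomp v`), so `ℚ_∞` has ONE place above `2`. [cite: Washington1997, §13.1]
[cite: NeukirchANT1999, Ch. II (7.13)(i)] -/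
theorem exists_mem_decomp_inv_mul_mem_kerSubgroup_two (hκ : κ.IsCyclotomic) {v : HeightOneSpectrum (𝓞 ℚ)}
    (hv : ((2 : ℕ) : 𝓞 ℚ) ∈ v.asIdeal) (σ : absoluteGaloisGroup ℚ) :
    ∃ d ∈ decomp v, d⁻¹ * σ ∈ κ.kerSubgroup := by
  obtain ⟨τ, hτ, hk⟩ := hκ.exists_mem_inertia_inv_mul_mem_kerSubgroup (primesEquiv_eq_two hv)
    (adicCompletionPrime_mem_primesAbove ℚ v) σ
  refine ⟨τ, ?_, hk⟩
  have hτD := Ideal.inertia_le_decompositionSubgroup (absoluteGaloisGroup ℚ) _ hτ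
  rw [decompositionSubgroup_adicCompletionPrime_eq_range] at hτD
  exact hτD

variable (M : Type) [AddCommGroup M] [DistribMulAction (absoluteGaloisGroup ℚ) M] [TopologicalSpace M]
  [DiscreteTopology M]

/-- **At the place above `2` of `ℚ_∞`, one local condition**: for the cyclotomic `ℤ₂`-extension and any discrete
`Γ_ℚ`-module `M`, `c ∈ H¹(ℚ_∞, M)` is locally trivial at EVERY place of `ℚ_∞` above `2` (all conjugates) iff it is
locally trivial at the chosen one. [cite: Washington1997, §13.1] [cite: Greenberg1989, §1 p. 98] -/
theorem forall_conjH1_mem_awayKer_iff_two (hκ : κ.IsCyclotomic) {v : HeightOneSpectrum (𝓞 ℚ)}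
    (hv : ((2 : ℕ) : 𝓞 ℚ) ∈ v.asIdeal) (c : subgroupH1 κ.kerSubgroup M) :
    (∀ σ : absoluteGaloisGroup ℚ, conjH1 κ.kerSubgroup M σ c ∈ awayKer κ.kerSubgroup M v) ↔
      c ∈ awayKer κ.kerSubgroup M v :=
  forall_conjH1_mem_awayKer_iff κ.kerSubgroup M (exists_mem_decomp_inv_mul_mem_kerSubgroup_two κ hκ hv) c

end Rat

/-! ## §3 The fine descent defect at `2` is finite -/

section Defect

open Rat.HeightOneSpectrum

variable (κ : ZpExtension ℚ 2) (W : WeierstrassCurve ℚ) [W.IsElliptic]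

omit [W.IsElliptic] in
/-- `Sel₀^{rel ∞}(ℚ_∞, E[2^∞])` is contained in the source `L = res⁻¹(Sel₀(ℚ(ζ_{2^∞}), E[2^∞]))` of the fine defect
(`InfResRel.resOfLe_fineRelaxed_mem_strictSelmerGroupOver_kerCyc`). [cite: GreenbergLNM1716, §3 and §4 (PDF p. 106)] -/
theorem fineSelmerInftyRelaxedInf_le_comap (hκ : κ.IsCyclotomic) :
    W.fineSelmerInftyRelaxedInf κ ≤
      (strictSelmerGroupOver (GaloisRep.cyclotomicCharacter ℚ 2).toMonoidHom.ker (W.geomPrimaryTorsion 2) 2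
          (fineData (W.geomPrimaryTorsion 2) 2)).comap
        (W.resOfLe 2 (InfRes.ker_cyclotomicCharacter_le_kerSubgroup κ hκ)) :=
  fun _ hc ↦ (InfResRel.resOfLe_fineRelaxed_mem_strictSelmerGroupOver_kerCyc κ W hκ hc).1

/-- **THE FINE DESCENT DEFECT AT `2` IS FINITE (no Imai, no Ribet).** For the cyclotomic `ℤ₂`-extension `ℚ_∞/ℚ`
and every elliptic curve `E = W/ℚ`, let `L ⊆ H¹(ℚ_∞, E[2^∞])` be the classes whose restriction to `ℚ(ζ_{2^∞})`
lies in the fine Selmer group `Sel₀(ℚ(ζ_{2^∞}), E[2^∞])` (Greenberg's strict Selmer group of the fine data over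
`ker χ₂`). Then `L / Sel₀^{rel ∞}(ℚ_∞, E[2^∞])` is FINITE: a class of `L` is in `Sel₀^{rel ∞}` iff it is locally
trivial at the ONE place above `2` (`OddSplitDescent.mem_fineSelmerInftyRelaxedInf_iff_resOfLe_mem_and_above_two`,
`forall_conjH1_mem_awayKer_iff_two`), and `res_{ker κ ⊓ D₂}(L)` lies in the finite inf–res defect
`{x ∈ H¹(ker κ ⊓ D₂, E[2^∞]) | res_{ker χ₂ ⊓ D₂} x = 0}` (`LocalTwo.finite_ker_res_kerCyclotomicCharacter_inf_two`).
With `…InfResSurj` (seed cell: `res` is onto the `Δ`-invariants) this is the finiteness of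
`coker(res₀ : Sel₀^{rel ∞}(ℚ_∞) → Sel₀(ℚ(ζ_{2^∞}))^Δ)`, i.e. `ker fyʳ` finite, `ℓ₍₂₎(ker fyʳ) = 0` in K₂ⁿᵉᵗʳ.
[cite: GreenbergLNM1716, §3 Lemma 3.1 and §4 (PDF p. 106)] [cite: Kato2004Asterisque, §17.13] -/
theorem finite_fineDefect_two (hκ : κ.IsCyclotomic) :
    Finite (↥((strictSelmerGroupOver (GaloisRep.cyclotomicCharacter ℚ 2).toMonoidHom.ker (W.geomPrimaryTorsion 2) 2
          (fineData (W.geomPrimaryTorsion 2) 2)).comap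
        (W.resOfLe 2 (InfRes.ker_cyclotomicCharacter_le_kerSubgroup κ hκ))) ⧸
      (W.fineSelmerInftyRelaxedInf κ).addSubgroupOf
        ((strictSelmerGroupOver (GaloisRep.cyclotomicCharacter ℚ 2).toMonoidHom.ker (W.geomPrimaryTorsion 2) 2
          (fineData (W.geomPrimaryTorsion 2) 2)).comap
        (W.resOfLe 2 (InfRes.ker_cyclotomicCharacter_le_kerSubgroup κ hκ)))) := by
  set h := InfRes.ker_cyclotomicCharacter_le_kerSubgroup κ hκ with hh
  set M := W.geomPrimaryTorsion 2 with hM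
  set Hχ := (GaloisRep.cyclotomicCharacter ℚ 2).toMonoidHom.ker with hHχ
  set L : AddSubgroup (W.subgroupH1 2 κ.kerSubgroup) :=
    (strictSelmerGroupOver Hχ M 2 (fineData M 2)).comap (W.resOfLe 2 h) with hL
  -- the place above `2`
  set v₂ : HeightOneSpectrum (𝓞 ℚ) := primesEquiv.symm ⟨2, Nat.prime_two⟩ with hv₂
  have hv₂mem : ((2 : ℕ) : 𝓞 ℚ) ∈ v₂.asIdeal := by
    have hgen : natGenerator v₂ = 2 := by
      change ((primesEquiv v₂ : Nat.Primes) : ℕ) = 2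
      rw [hv₂, Equiv.apply_symm_apply]
    have hdvd : natGenerator v₂ ∣ 2 := hgen ▸ dvd_rfl
    rw [natGenerator_dvd_iff, ← map_natCast (Rat.IsIntegralClosure.intEquiv (𝓞 ℚ)) 2,
      Ideal.apply_mem_of_equiv_iff] at hdvd
    exact hdvd
  have huniq : ∀ v : HeightOneSpectrum (𝓞 ℚ), ((2 : ℕ) : 𝓞 ℚ) ∈ v.asIdeal → v = v₂ := by
    intro v hv
    apply primesEquiv.injective
    rw [hv₂, Equiv.apply_symm_apply]
    exact Subtype.ext (primesEquiv_eq_two hv)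
  -- the local map `λ = res_{ker κ ⊓ D₂}` on `L`
  set D := decomp (K := ℚ) v₂ with hD
  let lam : L →+ subgroupH1 (κ.kerSubgroup ⊓ D) M :=
    (resOfLe M (inf_le_left : κ.kerSubgroup ⊓ D ≤ κ.kerSubgroup)).comp L.subtype
  -- its kernel is `Sel₀^{rel ∞} ∩ L`
  have hker : lam.ker = (W.fineSelmerInftyRelaxedInf κ).addSubgroupOf L := by
    ext ⟨c, hc⟩
    rw [AddMonoidHom.mem_ker, AddSubgroup.mem_addSubgroupOf]
    change resOfLe M inf_le_left c = 0 ↔ c ∈ W.fineSelmerInftyRelaxedInf κ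
    rw [OddSplitDescent.mem_fineSelmerInftyRelaxedInf_iff_resOfLe_mem_and_above_two κ W hκ c]
    constructor
    · intro h0
      refine ⟨hc, fun v hv σ ↦ ?_⟩
      rw [huniq v hv]
      exact (forall_conjH1_mem_awayKer_iff_two κ M hκ hv₂mem c).2 h0 σ
    · rintro ⟨-, habove⟩
      exact (forall_conjH1_mem_awayKer_iff_two κ M hκ hv₂mem c).1 (habove v₂ hv₂mem)
  -- its image lies in the finite inf–res defect at `2`
  have hfin := LocalTwo.finite_ker_res_kerCyclotomicCharacter_inf_two κ W hκ D
  have hrange : ∀ x : L, lam x ∈ {c : W.subgroupH1 2 (κ.kerSubgroup ⊓ D) |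
      W.resOfLe 2 (inf_le_inf_right D h) c = 0} := by
    rintro ⟨c, hc⟩
    change W.resOfLe 2 (inf_le_inf_right D h) (resOfLe M inf_le_left c) = 0
    -- `res_{ker χ₂ ⊓ D} c = res_{ker χ₂ ⊓ D ≤ ker χ₂} (res c) = 0` (the fine class upstairs is locally trivial at `2`)
    have hres := (mem_strictSelmerGroupOver_iff (H := Hχ) (M := M) (L := fineData M 2) _).1 hc
    have h2 := hres.2.2 v₂ hv₂mem 1
    rw [conjH1_one_holds Hχ M, AddMonoidHom.id_apply] at h2
    change _ ∈ (fineLocalDatum M v₂).strictKer _ at h2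
    rw [LocalAway.strictKer_fineLocalDatum_eq_awayKer, awayKer, AddMonoidHom.mem_ker] at h2
    have e1 := congrArg (fun f ↦ f c)
      (resOfLe_comp_holds (M := M) (inf_le_inf_right D h) (inf_le_left : κ.kerSubgroup ⊓ D ≤ κ.kerSubgroup))
    have e2 := congrArg (fun f ↦ f c)
      (resOfLe_comp_holds (M := M) (inf_le_left : Hχ ⊓ D ≤ Hχ) h)
    simp only [AddMonoidHom.coe_comp, Function.comp_apply] at e1 e2
    change resOfLe M (inf_le_inf_right D h) (resOfLe M inf_le_left c) = 0
    rw [e1, ← e2, h2]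
  haveI : Finite lam.range := by
    haveI := hfin.to_subtype
    refine Finite.of_injective (fun y : lam.range ↦ (⟨(y : subgroupH1 (κ.kerSubgroup ⊓ D) M), ?_⟩ :
      {c : W.subgroupH1 2 (κ.kerSubgroup ⊓ D) | W.resOfLe 2 (inf_le_inf_right D h) c = 0})) ?_
    · obtain ⟨x, hx⟩ := y.2
      rw [← hx]
      exact hrange x
    · intro y y' hyy'
      have e := congrArg Subtype.val hyy'
      dsimp only at e
      exact Subtype.ext e
  rw [← hker]
  exact Finite.of_equiv _ (QuotientAddGroup.quotientKerEquivRange lam).symm.toEquiv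

end Defect

/-! ## §4 Seed cell: `coker(res₀ : Sel₀^{rel ∞}(ℚ_∞) → Sel₀(ℚ(ζ_{2^∞}))^Δ)` is finite -/

section SeedCell

open Rat.HeightOneSpectrum Literature.NumberTheory.EllipticCurves.Greenberg1999

variable (κ : ZpExtension ℚ 2) (W : WeierstrassCurve ℚ) [W.IsElliptic]

/-- **`coker(res₀)` IS FINITE on the seed cell.** For an elliptic curve `E = W/ℚ` WITHOUT a rational point of
order `2` and the cyclotomic `ℤ₂`-extension: the `Δ = Gal(ℚ(ζ_{2^∞})/ℚ_∞)`-invariant classes of the fine Selmer group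
`Sel₀(ℚ(ζ_{2^∞}), E[2^∞])` (Greenberg's strict Selmer group of the fine data over `ker χ₂`; invariance = fixed by
`conj_g`, `g ∈ ker κ`) modulo the restrictions of `Sel₀^{rel ∞}(ℚ_∞, E[2^∞])` form a FINITE group. Proof: every
`Δ`-invariant class is a restriction (`InfResSurj.exists_resOfLe_eq_of_forall_conjH1_eq_two`, uses `E(ℚ(ζ_{2^∞}))[2^∞] = 0`),
so the quotient is the image of the finite fine defect `L / Sel₀^{rel ∞}` of §3. Dually: the fine comparison
`fyʳ : X₀(E/ℚ(ζ_{2^∞}))_Δ → X₀^{rel ∞}(E/ℚ_∞)` of K₂ⁿᵉᵗʳ has FINITE kernel, `ℓ₍₂₎(ker fyʳ) = 0` — no Imai, no Ribet,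
both signs of `Δ_E`. [cite: GreenbergLNM1716, §3 Lemma 3.1 and §4 (PDF p. 106)] [cite: Kato2004Asterisque, §17.13] -/
theorem finite_coker_fineRestriction_two (ht : ∀ x : ℚ, ¬ HasRationalTwoTorsionX W x) (hκ : κ.IsCyclotomic) :
    Finite (↥((strictSelmerGroupOver (GaloisRep.cyclotomicCharacter ℚ 2).toMonoidHom.ker (W.geomPrimaryTorsion 2) 2
          (fineData (W.geomPrimaryTorsion 2) 2)) ⊓
        ⨅ g ∈ κ.kerSubgroup, (W.conjH1 2 (GaloisRep.cyclotomicCharacter ℚ 2).toMonoidHom.ker g).eqLocus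
          (AddMonoidHom.id _)) ⧸
      ((W.fineSelmerInftyRelaxedInf κ).map (W.resOfLe 2 (InfRes.ker_cyclotomicCharacter_le_kerSubgroup κ hκ))).addSubgroupOf
        ((strictSelmerGroupOver (GaloisRep.cyclotomicCharacter ℚ 2).toMonoidHom.ker (W.geomPrimaryTorsion 2) 2
          (fineData (W.geomPrimaryTorsion 2) 2)) ⊓
        ⨅ g ∈ κ.kerSubgroup, (W.conjH1 2 (GaloisRep.cyclotomicCharacter ℚ 2).toMonoidHom.ker g).eqLocus
          (AddMonoidHom.id _))) := by
  set h := InfRes.ker_cyclotomicCharacter_le_kerSubgroup κ hκ with hh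
  set M := W.geomPrimaryTorsion 2 with hM
  set Hχ := (GaloisRep.cyclotomicCharacter ℚ 2).toMonoidHom.ker with hHχ
  set L : AddSubgroup (W.subgroupH1 2 κ.kerSubgroup) :=
    (strictSelmerGroupOver Hχ M 2 (fineData M 2)).comap (W.resOfLe 2 h) with hL
  set S : AddSubgroup (W.subgroupH1 2 Hχ) :=
    (strictSelmerGroupOver Hχ M 2 (fineData M 2)) ⊓
      ⨅ g ∈ κ.kerSubgroup, (W.conjH1 2 Hχ g).eqLocus (AddMonoidHom.id _) with hS
  have hmemS : ∀ c' : W.subgroupH1 2 Hχ, c' ∈ S ↔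
      c' ∈ strictSelmerGroupOver Hχ M 2 (fineData M 2) ∧ ∀ g ∈ κ.kerSubgroup, W.conjH1 2 Hχ g c' = c' := by
    intro c'
    simp only [hS, AddSubgroup.mem_inf, AddSubgroup.mem_iInf]
    exact Iff.rfl
  -- `res : L → S`
  let f : L →+ S := ((W.resOfLe 2 h).comp L.subtype).codRestrict S fun c ↦
    (hmemS _).2 ⟨c.2, fun g hg ↦ conjH1_resOfLe_of_mem (M := M) h hg (c : W.subgroupH1 2 κ.kerSubgroup)⟩
  have hf : ∀ c : L, ((f c : S) : W.subgroupH1 2 Hχ) = W.resOfLe 2 h c := fun _ ↦ rfl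
  -- onto: every `Δ`-invariant class is a restriction (seed cell)
  have hfsurj : Function.Surjective f := by
    rintro ⟨c', hc'⟩
    obtain ⟨hsel, hinv⟩ := (hmemS c').1 hc'
    obtain ⟨c, hc⟩ := InfResSurj.exists_resOfLe_eq_of_forall_conjH1_eq_two (W := W) (κ₂ := κ) ht hκ c' hinv
    refine ⟨⟨c, ?_⟩, Subtype.ext ?_⟩
    · change W.resOfLe 2 h c ∈ strictSelmerGroupOver Hχ M 2 (fineData M 2)
      rw [hc]; exact hsel
    · rw [hf]; exact hc
  -- the induced surjection of quotients
  have hle : (W.fineSelmerInftyRelaxedInf κ).addSubgroupOf L ≤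
      (((W.fineSelmerInftyRelaxedInf κ).map (W.resOfLe 2 h)).addSubgroupOf S).comap f := by
    intro c hc
    rw [AddSubgroup.mem_comap, AddSubgroup.mem_addSubgroupOf, hf]
    exact ⟨(c : W.subgroupH1 2 κ.kerSubgroup), AddSubgroup.mem_addSubgroupOf.mp hc, rfl⟩
  haveI := finite_fineDefect_two κ W hκ
  refine Finite.of_surjective (QuotientAddGroup.map _ _ f hle) fun y ↦ ?_
  induction y using QuotientAddGroup.induction_on with
  | H s =>
    obtain ⟨x, rfl⟩ := hfsurj s
    exact ⟨QuotientAddGroup.mk x, rfl⟩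

end SeedCell

end Summit.BirchSwinnertonDyer.BirchSwinnertonDyer.Theorems.AlignedTransportAtTwoFineRoad.CokerAtTwo

end
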